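import Summits.Ventures.HodgeRepro2.T5SU11ImproperHardyRemainderClass

/-!
# The equality case of the Hardy inequality on the class and the STRICT spectral gap

With the Hardy identity with remainder of `T5SU11ImproperHardyRemainderClass`
(`‖u′‖² − ‖u‖² = ∫_{(0,∞)} sinh 2t (u′Ξ − uΞ′)²/Ξ²` for `u = G^I_λ g`, every `λ > 1`, source rate `ε > 1`):

* **the equality case**: `‖u‖² = ‖u′‖²` forces the remainder integrand to vanish (`remainder_eqOn_zero_class`), so
  `u = c Ξ` on `(0, ∞)` (`exists_eq_mul_sph_one_class`); but `Ξ ≥ (1 + t) e^{−t}/8` (row 481) while `u = O(e^{−ε′t})`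
  with `ε′ > 1` (row 499), so `c = 0`, `u ≡ 0` (`greenSolI_eq_zero_of_hardy_eq`) and `g = (L − μ) u ≡ 0` on `(0, ∞)`
  (`eq_zero_of_greenSolI_eq_zero` — the resolvent is injective on the class — and `eq_zero_of_hardy_eq_class`);
* hence **the strict Hardy inequality on the class** for every source `g ≢ 0` (`hardy_inequality_strict_class`) and
  **the strict spectral gap `⟨g, G^I_λ g⟩ < −(λ − 1)² ‖G^I_λ g‖²`** (`inner_greenSolI_lt_neg`), every `λ > 1`; in particular
  `⟨g, G^I_λ g⟩ < 0` (`inner_greenSolI_neg`).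

Nothing is claimed about (N).

Blind lane: Mathlib + the HodgeRepro2 prefix only; no sorry; axioms ⊆ {propext, Classical.choice,
Quot.sound}.
-/

namespace Summit.Ventures.HodgeRepro2.T5SU11ImproperHardyStrictClass

open Filter Topology MeasureTheory intervalIntegral
open Set (Ioi Ioc Icc Ioo uIcc)
open T5SU11Cartan T5SU11SphericalFunction T5SU11SphericalBounds T5SU11SphericalContinuous
  T5SU11SphericalSolutionSpaceAll T5SU11SphericalDecay T5SU11SphericalXiLog T5SU11ReductionOfOrder T5SU11RadialGreen
  T5SU11RadialGreenImproper T5SU11RadialGreenImproperOrigin T5SU11RadialGreenImproperDecaySource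
  T5SU11RadialGreenImproperStable T5SU11GroundStateTransform T5SU11HardyRemainderResolvent
  T5SU11ImproperDerivativeBoundsAll T5SU11ImproperEnergyBracketAll T5SU11ImproperEnergyIdentityAll
  T5SU11ImproperHardyClass T5SU11ImproperHardyRemainderClass

section measure

variable [MeasurableSpace Circle] [BorelSpace Circle]

variable {lam : ℝ} (hlam : 1 < lam) {g : ℝ → ℝ} (hg : ContinuousOn g (Ioi 0))
  {M : ℝ} (hM : ∀ s ∈ Ioc (0 : ℝ) 1, |g s| ≤ M) (hM0 : 0 ≤ M)
  {ε C s₀ : ℝ} (hε : 2 - lam < ε) (hC : ∀ s, s₀ ≤ s → |g s| ≤ C * Real.exp (-ε * s))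
  (hε1 : 1 < ε)

/-! ### The equality case -/

include hlam hg hM hM0 hε hC hε1 in
/-- **Equality in Hardy forces the remainder integrand to vanish on `(0, ∞)`.** -/
theorem remainder_eqOn_zero_class
    (heq : ∫ t in Ioi 0, Real.sinh (2 * t) * greenSolI (fun t => sph lam (hyp t)) (sphDecay lam) g t ^ 2
      = ∫ t in Ioi 0, Real.sinh (2 * t) * greenSolI' (deriv fun t => sph lam (hyp t)) (sphDecay' lam)
          (fun t => sph lam (hyp t)) (sphDecay lam) g t ^ 2) :
    Set.EqOn (fun t => Real.sinh (2 * t) * (greenSolI' (deriv fun t => sph lam (hyp t)) (sphDecay' lam)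
        (fun t => sph lam (hyp t)) (sphDecay lam) g t * sph 1 (hyp t)
      - greenSolI (fun t => sph lam (hyp t)) (sphDecay lam) g t * deriv (fun t => sph 1 (hyp t)) t) ^ 2
        / sph 1 (hyp t) ^ 2) 0 (Ioi 0) := by
  have h0 : ∫ t in Ioi 0, Real.sinh (2 * t) * (greenSolI' (deriv fun t => sph lam (hyp t)) (sphDecay' lam)
        (fun t => sph lam (hyp t)) (sphDecay lam) g t * sph 1 (hyp t)
      - greenSolI (fun t => sph lam (hyp t)) (sphDecay lam) g t * deriv (fun t => sph 1 (hyp t)) t) ^ 2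
        / sph 1 (hyp t) ^ 2 = 0 := by
    rw [hardy_identity_class hlam hg hM hM0 hε hC hε1, heq, sub_self]
  have hnn : 0 ≤ᵐ[volume.restrict (Ioi 0)] (fun t => Real.sinh (2 * t) * (greenSolI' (deriv fun t => sph lam (hyp t))
        (sphDecay' lam) (fun t => sph lam (hyp t)) (sphDecay lam) g t * sph 1 (hyp t)
      - greenSolI (fun t => sph lam (hyp t)) (sphDecay lam) g t * deriv (fun t => sph 1 (hyp t)) t) ^ 2
        / sph 1 (hyp t) ^ 2) :=
    ae_restrict_of_forall_mem measurableSet_Ioi (fun t ht => remainder_nonneg _ _ (le_of_lt ht))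
  have hae := (integral_eq_zero_iff_of_nonneg_ae hnn (integrableOn_remainder_class hlam hg hM hM0 hε hC hε1)).mp h0
  exact Measure.eqOn_open_of_ae_eq hae isOpen_Ioi (continuousOn_remainder_class hlam hg hM hM0 hε hC) continuousOn_const

include hlam hg hM hM0 hε hC hε1 in
/-- **Equality in Hardy forces `u′Ξ − uΞ′ = 0` on `(0, ∞)`.** -/
theorem numerator_eq_zero_class
    (heq : ∫ t in Ioi 0, Real.sinh (2 * t) * greenSolI (fun t => sph lam (hyp t)) (sphDecay lam) g t ^ 2
      = ∫ t in Ioi 0, Real.sinh (2 * t) * greenSolI' (deriv fun t => sph lam (hyp t)) (sphDecay' lam)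
          (fun t => sph lam (hyp t)) (sphDecay lam) g t ^ 2) {t : ℝ} (ht : 0 < t) :
    greenSolI' (deriv fun t => sph lam (hyp t)) (sphDecay' lam) (fun t => sph lam (hyp t)) (sphDecay lam) g t
        * sph 1 (hyp t) - greenSolI (fun t => sph lam (hyp t)) (sphDecay lam) g t * deriv (fun t => sph 1 (hyp t)) t
      = 0 := by
  have h := remainder_eqOn_zero_class hlam hg hM hM0 hε hC hε1 heq ht
  simp only [Pi.zero_apply] at h
  have hs : Real.sinh (2 * t) ≠ 0 := (sinh_two_mul_pos ht).ne'
  have hΞ : sph 1 (hyp t) ^ 2 ≠ 0 := pow_ne_zero 2 (sph_hyp_pos 1 t).ne'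
  rcases div_eq_zero_iff.mp h with h1 | h1
  · rcases mul_eq_zero.mp h1 with h2 | h2
    · exact absurd h2 hs
    · exact pow_eq_zero_iff (by norm_num) |>.mp h2
  · exact absurd h1 hΞ

include hlam hg hM hM0 hε hC hε1 in
/-- **Equality in Hardy forces `u = c Ξ` on `(0, ∞)`.** -/
theorem exists_eq_mul_sph_one_class
    (heq : ∫ t in Ioi 0, Real.sinh (2 * t) * greenSolI (fun t => sph lam (hyp t)) (sphDecay lam) g t ^ 2
      = ∫ t in Ioi 0, Real.sinh (2 * t) * greenSolI' (deriv fun t => sph lam (hyp t)) (sphDecay' lam)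
          (fun t => sph lam (hyp t)) (sphDecay lam) g t ^ 2) :
    ∃ c : ℝ, ∀ t, 0 < t → greenSolI (fun t => sph lam (hyp t)) (sphDecay lam) g t = c * sph 1 (hyp t) := by
  set u := greenSolI (fun t => sph lam (hyp t)) (sphDecay lam) g with hu_def
  have hw : ∀ t, 0 < t → HasDerivAt (fun t => u t / sph 1 (hyp t)) 0 t := by
    intro t ht
    have hd := (hasDerivAt_greenSolI_class hlam hg hM hM0 hε hC ht).div (hasDerivAt_sph_hyp_deriv 1 t)
      (sph_hyp_pos 1 t).ne'
    rwa [numerator_eq_zero_class hlam hg hM hM0 hε hC hε1 heq ht, zero_div] at hd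
  refine ⟨u 1 / sph 1 (hyp 1), fun t ht => ?_⟩
  have hconst : ∀ c d, 0 < c → c ≤ d → u d / sph 1 (hyp d) = u c / sph 1 (hyp c) := by
    intro c d hc hcd
    have hcont : ContinuousOn (fun t => u t / sph 1 (hyp t)) (Icc c d) :=
      fun x hx => (hw x (lt_of_lt_of_le hc hx.1)).continuousAt.continuousWithinAt
    exact constant_of_has_deriv_right_zero hcont
      (fun x hx => (hw x (lt_of_lt_of_le hc hx.1)).hasDerivWithinAt) d ⟨hcd, le_rfl⟩
  have hΞ : sph 1 (hyp t) ≠ 0 := (sph_hyp_pos 1 t).ne'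
  have h : u t / sph 1 (hyp t) = u 1 / sph 1 (hyp 1) := by
    rcases le_total t 1 with ht1 | h1t
    · exact (hconst t 1 ht ht1).symm
    · exact hconst 1 t one_pos h1t
  exact (div_eq_iff hΞ).mp h

include hlam hg hM hM0 hε hC hε1 in
/-- **THE EQUALITY CASE ON THE CLASS**: `‖G^I_λ g‖² = ‖(G^I_λ g)′‖²` forces `G^I_λ g ≡ 0` on `(0, ∞)` — `u = c Ξ` with
`Ξ ≥ (1 + t) e^{−t}/8` while `u = O(e^{−ε′t})`, `ε′ > 1`, so `c = 0`. -/
theorem greenSolI_eq_zero_of_hardy_eq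
    (heq : ∫ t in Ioi 0, Real.sinh (2 * t) * greenSolI (fun t => sph lam (hyp t)) (sphDecay lam) g t ^ 2
      = ∫ t in Ioi 0, Real.sinh (2 * t) * greenSolI' (deriv fun t => sph lam (hyp t)) (sphDecay' lam)
          (fun t => sph lam (hyp t)) (sphDecay lam) g t ^ 2) {t : ℝ} (ht : 0 < t) :
    greenSolI (fun t => sph lam (hyp t)) (sphDecay lam) g t = 0 := by
  obtain ⟨c, hc⟩ := exists_eq_mul_sph_one_class hlam hg hM hM0 hε hC hε1 heq
  have hc0 : c = 0 := by
    by_contra hne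
    have hcpos : 0 < |c| := abs_pos.mpr hne
    have hmin : 1 < min ε lam := lt_min hε1 hlam
    set ε' := (1 + min ε lam) / 2 with hε'
    have hε'1 : 1 < ε' := by rw [hε']; linarith
    have hε'2 : ε' < min ε lam := by rw [hε']; linarith
    obtain ⟨K, T, hK, _, hKT⟩ := exists_abs_greenSolI_le_exp hlam hg hM hM0 hε hC hε'2
    set δ := ε' - 1 with hδ
    have hδpos : 0 < δ := by rw [hδ]; linarith
    have hq0 : 0 ≤ 8 * K / (|c| * δ) := by positivity
    set t₀ := max T 0 + 8 * K / (|c| * δ) + 1 with ht₀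
    have ht₀T : T ≤ t₀ := by have := le_max_left T 0; linarith
    have ht₀0 : 0 ≤ t₀ := by have := le_max_right T 0; linarith
    have ht₀pos : 0 < t₀ := by have := le_max_right T 0; linarith
    have h1 : |c| * sph 1 (hyp t₀) ≤ K * Real.exp (-ε' * t₀) := by
      have := hKT t₀ ht₀T
      rwa [hc t₀ ht₀pos, abs_mul, abs_of_pos (sph_hyp_pos 1 t₀)] at this
    have h2 : 1 / 8 * (1 + t₀) * Real.exp (-t₀) ≤ sph 1 (hyp t₀) := le_sph_one_hyp ht₀0
    have h3 : Real.exp (-ε' * t₀) = Real.exp (-t₀) * Real.exp (-(δ * t₀)) := by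
      rw [← Real.exp_add]; congr 1; rw [hδ]; ring
    have hden : 0 < 1 + δ * t₀ := by positivity
    have h4 : Real.exp (-(δ * t₀)) ≤ 1 / (1 + δ * t₀) := by
      rw [Real.exp_neg, one_div]
      exact inv_anti₀ hden (by linarith [Real.add_one_le_exp (δ * t₀)])
    have hE : 0 < Real.exp (-t₀) := Real.exp_pos _
    have hkey : |c| * (1 / 8 * (1 + t₀) * Real.exp (-t₀)) ≤ K * (Real.exp (-t₀) * (1 / (1 + δ * t₀))) := by
      calc |c| * (1 / 8 * (1 + t₀) * Real.exp (-t₀)) ≤ |c| * sph 1 (hyp t₀) :=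
            mul_le_mul_of_nonneg_left h2 (abs_nonneg _)
        _ ≤ K * Real.exp (-ε' * t₀) := h1
        _ = K * (Real.exp (-t₀) * Real.exp (-(δ * t₀))) := by rw [h3]
        _ ≤ K * (Real.exp (-t₀) * (1 / (1 + δ * t₀))) :=
            mul_le_mul_of_nonneg_left (mul_le_mul_of_nonneg_left h4 hE.le) hK
    have hkey2 : |c| * (1 + t₀) * (1 + δ * t₀) ≤ 8 * K := by
      rw [show |c| * (1 / 8 * (1 + t₀) * Real.exp (-t₀)) = Real.exp (-t₀) * (|c| * (1 + t₀) / 8) by ring,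
        show K * (Real.exp (-t₀) * (1 / (1 + δ * t₀))) = Real.exp (-t₀) * (K / (1 + δ * t₀)) by ring] at hkey
      have h' := le_of_mul_le_mul_left hkey hE
      rw [div_le_div_iff₀ (by norm_num) hden] at h'
      linarith
    have hdt : 8 * K / |c| ≤ δ * t₀ := by
      have e : δ * (8 * K / (|c| * δ)) = 8 * K / |c| := by field_simp
      have hT0 : 0 ≤ δ * max T 0 := mul_nonneg hδpos.le (le_max_right T 0)
      calc 8 * K / |c| = 0 + δ * (8 * K / (|c| * δ)) + 0 := by rw [e]; ring
        _ ≤ δ * max T 0 + δ * (8 * K / (|c| * δ)) + δ := by linarith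
        _ = δ * t₀ := by rw [ht₀]; ring
    have hcdt : 8 * K ≤ |c| * (δ * t₀) := by
      calc 8 * K = |c| * (8 * K / |c|) := by field_simp
        _ ≤ |c| * (δ * t₀) := mul_le_mul_of_nonneg_left hdt (abs_nonneg _)
    have e : |c| * (1 + t₀) * (1 + δ * t₀) = |c| + |c| * (δ * t₀) + |c| * t₀ + |c| * t₀ * (δ * t₀) := by ring
    have hn1 : 0 ≤ |c| * t₀ := mul_nonneg (abs_nonneg _) ht₀0
    have hn2 : 0 ≤ |c| * t₀ * (δ * t₀) := mul_nonneg hn1 (mul_nonneg hδpos.le ht₀0)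
    linarith
  rw [hc t ht, hc0, zero_mul]

include hlam hg hM hM0 hε hC in
/-- **The resolvent is injective on the class**: `G^I_λ g ≡ 0` on `(0, ∞)` forces `g = (L − λ(λ−2))(G^I_λ g) ≡ 0` on
`(0, ∞)`. -/
theorem eq_zero_of_greenSolI_eq_zero
    (hu0 : ∀ s, 0 < s → greenSolI (fun t => sph lam (hyp t)) (sphDecay lam) g s = 0) {t : ℝ} (ht : 0 < t) :
    g t = 0 := by
  set u := greenSolI (fun t => sph lam (hyp t)) (sphDecay lam) g with hu_def
  set u' := greenSolI' (deriv fun t => sph lam (hyp t)) (sphDecay' lam) (fun t => sph lam (hyp t)) (sphDecay lam) g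
    with hu'_def
  have hu'0 : ∀ s, 0 < s → u' s = 0 := by
    intro s hs
    have hev : u =ᶠ[𝓝 s] (fun _ => (0 : ℝ)) := eventuallyEq_of_mem (Ioi_mem_nhds hs) (fun x hx => hu0 x hx)
    exact (hasDerivAt_greenSolI_class hlam hg hM hM0 hε hC hs).unique
      ((hasDerivAt_const s (0 : ℝ)).congr_of_eventuallyEq hev)
  have hu''0 : greenSolI'' (deriv (deriv fun t => sph lam (hyp t))) (sphDecay'' lam) (deriv fun t => sph lam (hyp t))
      (sphDecay' lam) (fun t => sph lam (hyp t)) (sphDecay lam) g t = 0 := by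
    have hev : u' =ᶠ[𝓝 t] (fun _ => (0 : ℝ)) := eventuallyEq_of_mem (Ioi_mem_nhds ht) (fun x hx => hu'0 x hx)
    exact (hasDerivAt_greenSolI'_class hlam hg hM hM0 hε hC ht).unique
      ((hasDerivAt_const t (0 : ℝ)).congr_of_eventuallyEq hev)
  have hode : Real.sinh (2 * t) * greenSolI'' (deriv (deriv fun t => sph lam (hyp t))) (sphDecay'' lam)
      (deriv fun t => sph lam (hyp t)) (sphDecay' lam) (fun t => sph lam (hyp t)) (sphDecay lam) g t
      + 2 * Real.cosh (2 * t) * u' t = lam * (lam - 2) * Real.sinh (2 * t) * u t + Real.sinh (2 * t) * g t :=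
    greenSolI_ode (hode_sph lam) (fun _ hs => sphDecay_ode hlam hs) (fun _ hs => wronskian_sphDecay hlam hs) (g := g) ht
  rw [hu''0, hu'0 t ht, hu0 t ht] at hode
  have hs : Real.sinh (2 * t) ≠ 0 := (sinh_two_mul_pos ht).ne'
  have : Real.sinh (2 * t) * g t = 0 := by linear_combination -hode
  rcases mul_eq_zero.mp this with h | h
  · exact absurd h hs
  · exact h

include hlam hg hM hM0 hε hC hε1 in
/-- **Equality in Hardy forces the source to vanish**: `g = (L − λ(λ−2))(G^I_λ g) ≡ 0` on `(0, ∞)`. -/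
theorem eq_zero_of_hardy_eq_class
    (heq : ∫ t in Ioi 0, Real.sinh (2 * t) * greenSolI (fun t => sph lam (hyp t)) (sphDecay lam) g t ^ 2
      = ∫ t in Ioi 0, Real.sinh (2 * t) * greenSolI' (deriv fun t => sph lam (hyp t)) (sphDecay' lam)
          (fun t => sph lam (hyp t)) (sphDecay lam) g t ^ 2) {t : ℝ} (ht : 0 < t) : g t = 0 :=
  eq_zero_of_greenSolI_eq_zero hlam hg hM hM0 hε hC
    (fun _ hs => greenSolI_eq_zero_of_hardy_eq hlam hg hM hM0 hε hC hε1 heq hs) ht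

/-! ### The strict inequalities -/

include hlam hg hM hM0 hε hC hε1 in
/-- **THE STRICT HARDY INEQUALITY ON THE CLASS**: `‖G^I_λ g‖² < ‖(G^I_λ g)′‖²` for every source `g ≢ 0` on `(0, ∞)`,
every `λ > 1`, source rate `ε > 1`. -/
theorem hardy_inequality_strict_class (hne : ∃ t, 0 < t ∧ g t ≠ 0) :
    ∫ t in Ioi 0, Real.sinh (2 * t) * greenSolI (fun t => sph lam (hyp t)) (sphDecay lam) g t ^ 2
      < ∫ t in Ioi 0, Real.sinh (2 * t) * greenSolI' (deriv fun t => sph lam (hyp t)) (sphDecay' lam)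
          (fun t => sph lam (hyp t)) (sphDecay lam) g t ^ 2 := by
  refine lt_of_le_of_ne (hardy_inequality_class hlam hg hM hM0 hε hC hε1) (fun heq => ?_)
  obtain ⟨t, ht, hgt⟩ := hne
  exact hgt (eq_zero_of_hardy_eq_class hlam hg hM hM0 hε hC hε1 heq ht)

include hlam hg hM hM0 hε hC hε1 in
/-- **THE STRICT SPECTRAL GAP OF THE RESOLVENT ON THE CLASS**: `⟨g, G^I_λ g⟩ < −(λ − 1)² ‖G^I_λ g‖²` for every source
`g ≢ 0` on `(0, ∞)`, every `λ > 1`, source rate `ε > 1`. -/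
theorem inner_greenSolI_lt_neg (hne : ∃ t, 0 < t ∧ g t ≠ 0) :
    ∫ t in Ioi 0, Real.sinh (2 * t) * (g t * greenSolI (fun t => sph lam (hyp t)) (sphDecay lam) g t)
      < -((lam - 1) ^ 2 * ∫ t in Ioi 0, Real.sinh (2 * t) * greenSolI (fun t => sph lam (hyp t)) (sphDecay lam) g t ^ 2) := by
  have hE := energy_identity_class hlam hg hM hM0 hε hC hε1
  have hH := hardy_inequality_strict_class hlam hg hM hM0 hε hC hε1 hne
  have hsq : (lam - 1) ^ 2 = 1 + lam * (lam - 2) := by ring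
  rw [hsq]
  linarith

include hlam hg hM hM0 hε hC hε1 in
/-- **The resolvent is strictly negative on the class**: `⟨g, G^I_λ g⟩ < 0` for every source `g ≢ 0` on `(0, ∞)`. -/
theorem inner_greenSolI_neg (hne : ∃ t, 0 < t ∧ g t ≠ 0) :
    ∫ t in Ioi 0, Real.sinh (2 * t) * (g t * greenSolI (fun t => sph lam (hyp t)) (sphDecay lam) g t) < 0 := by
  have h := inner_greenSolI_lt_neg hlam hg hM hM0 hε hC hε1 hne
  have hB0 : 0 ≤ ∫ t in Ioi 0, Real.sinh (2 * t) * greenSolI (fun t => sph lam (hyp t)) (sphDecay lam) g t ^ 2 := by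
    apply setIntegral_nonneg measurableSet_Ioi
    intro t ht
    have ht0 : 0 < t := ht
    exact mul_nonneg (Real.sinh_nonneg_iff.mpr (by linarith)) (sq_nonneg _)
  nlinarith [sq_nonneg (lam - 1)]

end measure

end Summit.Ventures.HodgeRepro2.T5SU11ImproperHardyStrictClass
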